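import Summits.BirchSwinnertonDyer.BirchSwinnertonDyer.Theorems.KolyvaginRankRigidityAtTwoOppositeSignReciprocityKTerm
import HarnessLib

/-!
# Crux U1 `KolyvaginBoundedDefectAtTwo` (stmt-BirchSwinnertonDyer-28083), LINE 17 `kolyvagin_swap` — OSR
# `OppositeSignReciprocityAtTwo`, part 2/3: `oppositeSignReciprocityAtTwo_core` — OSR in the frame currency of S1's
# `primeSwapAtTwoLossy_core` (Weil data, Poitou–Tate families, transverse structures, P8, P4, P7a, Q2 BY NAME, T2)

Authored by the pen `bsd-idea-1` g15 (planner; HOME `line17/OppositeSignReciprocityAtTwo.lean` sha16 67c18ff6e0b42450, farm rc 0,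
critic #322 reproduced); landed (split into three files ≤ 400 lines, statements unchanged, §4's inline `def` dropped in favour of the
verbatim body) by width seat `bsd-line-krr2-p2` g18, `--supports stmt-BirchSwinnertonDyer-28083` (helper). THEOREMS ONLY; the end
result is CONDITIONAL on `prop37_2_frobeniusCongruence` (the registered print stub P372 of the line of record); nothing here proves
SWα, U1, a rung or BSD. BSD is NOT proved.

`oppositeSignReciprocityAtTwo_core` — **OSR in the frame currency of S1's `primeSwapAtTwoLossy_core`** (same section
variables: Weil data `e`, Poitou–Tate families `inv`, transverse structures `𝒯`, P8 `h𝒯sd`, P4, P7a (`c₇`), Q2, T2 (`t`); NO P5, NO P7b,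
NO S2, NO Čebotarev): for `z ∈ H¹_{𝓕(m)}` and the datum `dup` of conductor `n·ℓ` (compatible with `dat` of conductor `n`, `m ∣ n`,
`ℓ ∤ n` Kolyvagin of index `≥ M+1`, `v ∣ ℓ`) of the SAME `τ`-sign `ε`, with `2^a z ∉ ker loc_v`, `2^b c_M(n) ∉ ker loc_v` and
`j + M + t + c₇ ≤ a + b + 1`:  **some seed place `w ∣ q' ∣ n/m` has `2^j c_M(nℓ) ∉ H¹_f(K_w)`.**  Proof (≈ the OSR proof map of card
§v7.7 (1), simplified): if `2^j c_M(nℓ)` were Kummer at every seed place then `C'' = 2^{j+t} c_M(nℓ) ∈ H¹_{𝓕(m·ℓ)}` (P4 at the places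
of `m` and at `v`, T2 off `nℓ`, the hypothesis at the seed places), so the ONE-term case of part 1 (`c = m·ℓ ⊇ m`; `ℓ` inert ⇒ the only
place of `m·ℓ` not over `m` is `v`) gives `⟨z, C''⟩_v = 0`, while P7a at `v` (`z` Kummer at `v ∤ m` with `2^a loc_v z ≠ 0`; `2^{b-t-j}
loc_v C'' ∉ H¹_f(K_v)` by Q2-UP at `ℓ` from `2^b c_M(n) ∉ ker loc_v`) gives `2^{a+b-t-j+1-M-c₇}⟨z, C''⟩_v ≠ 0` — contradiction.
References (locators only; no cited FACT is declared): [cite: Kolyvagin1991MathAnn, §2 Thm. 2.2 (p. 257)]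
[cite: McCallumLMS1991, §5 Prop. 5.2, Lemma 5.3; §4 Prop. 4.4] [cite: GrossLMS1991, Prop. 3.7, Prop. 6.2]
[cite: Howard2004HeegnerKolyvagin, Thm. 2.1.11].
Design: no definitions; `K : Type`; axioms `propext`, `Classical.choice`, `Quot.sound`.
-/

set_option autoImplicit false
-- the Theorems namespace of this sub repeats the summit name by design (D-0017 nested layout)
set_option linter.dupNamespace false

noncomputable section

open scoped Classical Pointwise
open Function NumberField IsDedekindDomain WeierstrassCurve Field
open Literature.NumberTheory.EllipticCurves Literature.NumberTheory.GaloisRepresentations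
open Literature.NumberTheory.EllipticCurves.Jetchev2008 Literature.NumberTheory.EllipticCurves.ModularForms
open Literature.NumberTheory.GaloisCohomology
open Literature.NumberTheory.GaloisRepresentations.DiscreteGaloisModule (localTatePairingZMod
  tateDual SelmerStructure)
open Summit.BirchSwinnertonDyer.Rank1Residual.JET.SelmerVocabulary
open Summit.BirchSwinnertonDyer.Rank1Residual.JET.GlobalDuality

namespace Summit.BirchSwinnertonDyer.BirchSwinnertonDyer.Theorems.KolyvaginLowerBoundAtTwo

open Summit.BirchSwinnertonDyer.BirchSwinnertonDyer.Theses.KolyvaginRankRigidityAtTwo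
open Summit.BirchSwinnertonDyer.BirchSwinnertonDyer.Theses.GenusKolyvaginAtTwo (KolyvaginRelationAtTwo)

section Frame

variable {K : Type} [Field K] [NumberField K] (W : WeierstrassCurve ℚ) [W.IsElliptic]
  [W.IsGloballyMinimal] [(W.baseChange K).IsElliptic] [NeZero (W.conductorNorm ℤ)]
  [∀ M : ℕ, NeZero (2 ^ M)] [∀ M : ℕ, Finite (geomTorsion (W.baseChange K) ((2 ^ M : ℕ) : ℤ))]
  (τ : K ≃ₐ[ℚ] K)
  (Dt : ModularParametrizationData W (W.conductorNorm ℤ)) (β : ℤ) (ι : K →+* ℂ)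
  -- the Weil data, one per level
  (e : ∀ M : ℕ, geomTorsion (W.baseChange K) ((2 ^ M : ℕ) : ℤ) →
    geomTorsion (W.baseChange K) ((2 ^ M : ℕ) : ℤ) → AlgebraicClosure K)
  (hμ : ∀ M S T, e M S T ^ (2 ^ M) = 1)
  (hadd₁ : ∀ M S₁ S₂ T, e M (S₁ + S₂) T = e M S₁ T * e M S₂ T)
  (hadd₂ : ∀ M S T₁ T₂, e M S (T₁ + T₂) = e M S T₁ * e M S T₂)
  (hgal : ∀ M (g : absoluteGaloisGroup K) (S T : geomTorsion (W.baseChange K) ((2 ^ M : ℕ) : ℤ)),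
    g • e M S T = e M (g • S) (g • T))
  (halt : ∀ M T, e M T T = 1) (hnondeg : ∀ M T, (∀ S, e M S T = 1) → T = 0)
  -- the Poitou–Tate families, one per level
  (inv : ∀ M : ℕ, LocalInvariants K (2 ^ M))
  -- the transverse structures, one per level
  (𝒯 : ∀ M : ℕ, SelmerStructure ((W.baseChange K).torsionGaloisModule ((2 ^ M : ℕ) : ℤ)))
  -- the habitat (the part of it Q2 and the Selmer lemmas consume)
  (hCM : ¬ W.HasCM) (hsur : ∀ m : ℕ, W.HasSurjectiveModNGaloisRep (2 ^ m : ℕ)) (hK : IsImaginaryQuadratic K)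
  (hne3 : NumberField.discr K ≠ -3) (hne4 : NumberField.discr K ≠ -4)
  (hHN : SatisfiesHeegnerHypothesis (W.conductorNorm ℤ) K)
  (hperf : ∀ M, (inv M).IsPerfect) (hvan : ∀ M, (inv M).SumLocalTermEqZero)
  -- P8: the transverse package at `2`
  (h𝒯sd : ∀ (M c : ℕ), ∀ v ∈ placesDividing K c,
    (inv M).dualTransported (𝒯 M) (weilDualIntertwining (W.baseChange K) (2 ^ M) (e M) (hμ M) (hadd₁ M)
      (hadd₂ M) (hgal M)) (Sum.inr v) = 𝒯 M (Sum.inr v))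
  -- P4: transversality at the primes of the conductor (margin one)
  (hP4 : ∀ (M c : ℕ) (dat : KolyvaginHeegnerData Dt β ι c),
    KolyvaginDescent.KolSupp (Zhang2014.IsKolyvaginPrime (W.conductorNorm ℤ) W K 2) c → 1 ≤ M →
    (∀ q ∈ c.primeFactors, M + 1 ≤ Zhang2014.kolyvaginIndex W 2 q) →
    ∀ w ∈ placesDividing K c,
      galoisCohomology.localization ((W.baseChange K).torsionGaloisModule ((2 ^ M : ℕ) : ℤ)) (Sum.inr w) 1
        (dat.kolyvaginClass Nat.prime_two M) ∈ 𝒯 M (Sum.inr w))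
  -- P7a: lower bound of the pairing order at a fresh Kolyvagin prime OF INDEX ≥ M + 1 (the numerics-only shape of
  -- `swapPairing_pow_smul_ne_zero_at_two_of_index`, c₇ = 2 there)
  {c₇ : ℕ}
  (hP7a : ∀ (M ℓ : ℕ) (v : HeightOneSpectrum (𝓞 K))
    (w C : galoisCohomology ((W.baseChange K).torsionGaloisModule ((2 ^ M : ℕ) : ℤ)) 1) (s : ℤ) (a b : ℕ),
    (s = 1 ∨ s = -1) → Zhang2014.IsKolyvaginPrime (W.conductorNorm ℤ) W K 2 ℓ →
    M + 1 ≤ Zhang2014.kolyvaginIndex W 2 ℓ → ((ℓ : ℕ) : 𝓞 K) ∈ v.asIdeal →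
    conjAct W τ ((2 ^ M : ℕ) : ℤ) w = s • w → conjAct W τ ((2 ^ M : ℕ) : ℤ) C = s • C →
    galoisCohomology.localization ((W.baseChange K).torsionGaloisModule ((2 ^ M : ℕ) : ℤ)) (Sum.inr v) 1 w ∈
      (W.baseChange K).kummerSelmerStructure ((2 ^ M : ℕ) : ℤ) (Sum.inr v) →
    ((2 ^ a : ℕ) : ℤ) • galoisCohomology.localization ((W.baseChange K).torsionGaloisModule ((2 ^ M : ℕ) : ℤ))
      (Sum.inr v) 1 w ≠ 0 →
    ((2 ^ b : ℕ) : ℤ) • galoisCohomology.localization ((W.baseChange K).torsionGaloisModule ((2 ^ M : ℕ) : ℤ))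
      (Sum.inr v) 1 C ∉ (W.baseChange K).kummerSelmerStructure ((2 ^ M : ℕ) : ℤ) (Sum.inr v) →
    M + c₇ ≤ a + b + 1 →
    (2 ^ (a + b + 1 - M - c₇) : ℕ) •
        localTatePairingZMod ((W.baseChange K).torsionGaloisModule ((2 ^ M : ℕ) : ℤ)) (2 ^ M) (Sum.inr v)
          (inv M (Sum.inr v))
          (galoisCohomology.localization ((W.baseChange K).torsionGaloisModule ((2 ^ M : ℕ) : ℤ)) (Sum.inr v) 1 w)
          (galoisCohomology.localization (((W.baseChange K).torsionGaloisModule ((2 ^ M : ℕ) : ℤ)).tateDual (2 ^ M))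
            (Sum.inr v) 1
            (galoisCohomology.map (weilDualIntertwining (W.baseChange K) (2 ^ M) (e M) (hμ M) (hadd₁ M) (hadd₂ M)
              (hgal M)) 1 C)) ≠ 0)
  -- Q2 by name (landed modulo Gross 1991 Prop. 3.7 (2))
  (hQ2 : KolyvaginRelationAtTwo)
  -- T2 (landed, p612348)
  {t : ℕ}
  (hT2 : ∀ (n : ℕ) (d : KolyvaginHeegnerData Dt β ι n) (M : ℕ),
    KolyvaginDescent.KolSupp (Zhang2014.IsKolyvaginPrime (W.conductorNorm ℤ) W K 2) n →
    1 ≤ M → (M : ℕ∞) ≤ Zhang2014.levelIndex W 2 n →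
    ∀ v : HeightOneSpectrum (𝓞 K), ((n : ℕ) : 𝓞 K) ∉ v.asIdeal →
      ((2 ^ t : ℕ) : ℤ) • d.kolyvaginClass Nat.prime_two M ∈
        selmerLocalKer (W.baseChange K) (v.adicCompletion K) ((2 ^ M : ℕ) : ℤ))

include halt hnondeg hCM hsur hK hne3 hne4 hHN hperf hvan h𝒯sd hP4 hP7a hQ2 hT2 in
/-- **OSR core — opposite-sign reciprocity with a Kummer partner, in the S1 frame currency.**  `n` a square-free product of
Kolyvagin primes of index `≥ M + 1`, `m ∣ n`, `ℓ ∤ n` a Kolyvagin prime of index `≥ M + 1` with place `v`, `dat`/`dup` compatible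
data of conductors `n`/`n·ℓ`, `z ∈ H¹_{𝓕(m)}(K, E[2^M])` with the same `τ`-sign `ε` as `c_M(nℓ)`; if `2^a z ∉ ker loc_v`,
`2^b c_M(n) ∉ ker loc_v` and `j + M + t + c₇ ≤ a + b + 1`, then `2^j c_M(nℓ)` is NOT in the Kummer subgroup at some place over a
prime of the seed block `n / m`.  (In OSR's wording: the opposite-sign partner `z` — sign `−u`, `u` the sign of `c_M(n)`, so `−u`
is the sign of `c_M(nℓ)` by the kernel sign law — forces a non-Kummer SEED TERM.)  One-term reciprocity (§1 with `c = m·ℓ`) + P7a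
at `v` + Q2-UP at `ℓ` + P4/T2 memberships; no Čebotarev, no P5/P7b/S2.
[cite: Kolyvagin1991MathAnn, §2 Thm. 2.2 (p. 257)] [cite: McCallumLMS1991, §5 Prop. 5.2, Lemma 5.3; §4 Prop. 4.4]
[cite: GrossLMS1991, Prop. 3.7, Prop. 6.2] [cite: Howard2004HeegnerKolyvagin, Thm. 2.1.11] -/
theorem oppositeSignReciprocityAtTwo_core {M m n ℓ a b j : ℕ} {ε : ℤ}
    (dat : KolyvaginHeegnerData Dt β ι n) (dup : KolyvaginHeegnerData Dt β ι (n * ℓ))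
    (z : galoisCohomology ((W.baseChange K).torsionGaloisModule ((2 ^ M : ℕ) : ℤ)) 1)
    (v : HeightOneSpectrum (𝓞 K))
    (hM : 1 ≤ M) (hn : Squarefree n)
    (hnK : ∀ q ∈ n.primeFactors, Zhang2014.IsKolyvaginPrime (W.conductorNorm ℤ) W K 2 q ∧
      M + 1 ≤ Zhang2014.kolyvaginIndex W 2 q)
    (hmn : m ∣ n) (hℓK : Zhang2014.IsKolyvaginPrime (W.conductorNorm ℤ) W K 2 ℓ) (hℓn : ¬ ℓ ∣ n)
    (hℓI : M + 1 ≤ Zhang2014.kolyvaginIndex W 2 ℓ) (hv : ((ℓ : ℕ) : 𝓞 K) ∈ v.asIdeal)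
    (hε : ε = 1 ∨ ε = -1)
    (hz : z ∈ (selmerF W ((2 ^ M : ℕ) : ℤ) (𝒯 M) (placesDividing K m)).selmerGroup)
    (hzτ : conjAct W τ ((2 ^ M : ℕ) : ℤ) z = ε • z)
    (hdupτ : conjAct W τ ((2 ^ M : ℕ) : ℤ) (dup.kolyvaginClass Nat.prime_two M) =
      ε • dup.kolyvaginClass Nat.prime_two M)
    (hza : ((2 ^ a : ℕ) : ℤ) • z ∉ (W.baseChange K).torsionLocalKer (v.adicCompletion K) ((2 ^ M : ℕ) : ℤ))
    (hcb : ((2 ^ b : ℕ) : ℤ) • dat.kolyvaginClass Nat.prime_two M ∉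
      (W.baseChange K).torsionLocalKer (v.adicCompletion K) ((2 ^ M : ℕ) : ℤ))
    (hab : j + M + (t + c₇) ≤ a + b + 1)
    (hσ : ∀ l' ∈ n.primeFactors, ∀ (x : ringClassField K ι n) (x' : ringClassField K ι (n * ℓ)),
      (x : ℂ) = x' → ((dup.σ l' x' : ringClassField K ι (n * ℓ)) : ℂ) = (dat.σ l' x : ℂ))
    (hS : ∀ s ∈ dat.S, ∃ s' ∈ dup.S, ∀ (x : ringClassField K ι n) (x' : ringClassField K ι (n * ℓ)),
      (x : ℂ) = x' → ((s' x' : ringClassField K ι (n * ℓ)) : ℂ) = (s x : ℂ))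
    (hS' : ∀ s' ∈ dup.S, ∃ s ∈ dat.S, ∀ (x : ringClassField K ι n) (x' : ringClassField K ι (n * ℓ)),
      (x : ℂ) = x' → ((s' x' : ringClassField K ι (n * ℓ)) : ℂ) = (s x : ℂ))
    (hemb : ∀ (x : ringClassField K ι n) (x' : ringClassField K ι (n * ℓ)), (x : ℂ) = x' →
      dup.emb x' = dat.emb x) :
    ∃ q ∈ (n / m).primeFactors, ∃ w : HeightOneSpectrum (𝓞 K), ((q : ℕ) : 𝓞 K) ∈ w.asIdeal ∧
      ((2 ^ j : ℕ) : ℤ) • dup.kolyvaginClass Nat.prime_two M ∉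
        selmerLocalKer (W.baseChange K) (w.adicCompletion K) ((2 ^ M : ℕ) : ℤ) := by
  classical
  -- (0) numerics
  have hn0 : n ≠ 0 := hn.ne_zero
  have hm0 : m ≠ 0 := fun h ↦ hn0 (Nat.eq_zero_of_zero_dvd (h ▸ hmn))
  have hnm0 : n / m ≠ 0 := fun h ↦ hn0 (by rw [← Nat.div_mul_cancel hmn, h, zero_mul])
  have hℓp : ℓ.Prime := hℓK.1
  have hℓ0 : ℓ ≠ 0 := hℓp.ne_zero
  have hℓm : ¬ ℓ ∣ m := fun h ↦ hℓn (h.trans hmn)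
  have hN : Squarefree (n * ℓ) :=
    (Nat.squarefree_mul ((Nat.Prime.coprime_iff_not_dvd hℓp).mpr hℓn).symm).mpr ⟨hn, hℓp.squarefree⟩
  have hN0 : n * ℓ ≠ 0 := hN.ne_zero
  have hNpf : (n * ℓ).primeFactors = n.primeFactors ∪ {ℓ} := by
    rw [Nat.primeFactors_mul hn0 hℓ0, hℓp.primeFactors]
  have hNK : ∀ q ∈ (n * ℓ).primeFactors, Zhang2014.IsKolyvaginPrime (W.conductorNorm ℤ) W K 2 q ∧
      M + 1 ≤ Zhang2014.kolyvaginIndex W 2 q := by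
    intro q hq
    rw [hNpf, Finset.mem_union, Finset.mem_singleton] at hq
    rcases hq with hq | rfl
    · exact hnK q hq
    · exact ⟨hℓK, hℓI⟩
  have hNK' : ∀ q ∈ (n * ℓ).primeFactors, Zhang2014.IsKolyvaginPrime (W.conductorNorm ℤ) W K 2 q ∧
      M ≤ Zhang2014.kolyvaginIndex W 2 q :=
    fun q hq ↦ ⟨(hNK q hq).1, Nat.le_of_succ_le (hNK q hq).2⟩
  have hNKol : KolyvaginDescent.KolSupp (Zhang2014.IsKolyvaginPrime (W.conductorNorm ℤ) W K 2) (n * ℓ) :=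
    ⟨hN, fun q hq ↦ (hNK q hq).1⟩
  have hmℓ0 : m * ℓ ≠ 0 := mul_ne_zero hm0 hℓ0
  have hmℓN : m * ℓ ∣ n * ℓ := Nat.mul_dvd_mul_right hmn ℓ
  -- (1) `2^a z ≠ 0` forces `a < M`; hence `t + j ≤ b`
  have hMz : ((2 ^ M : ℕ) : ℤ) • z = 0 := zsmul_galH1Torsion_eq_zero (W.baseChange K) _ z
  have haM : a < M := by
    by_contra h
    exact hza ((mem_torsionLocalKer_two_pow_iff W M v _).mpr
      (by rw [two_pow_zsmul_eq_zero_of_le_swap (not_lt.mp h) hMz, map_zero]))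
  have htjb : t + j ≤ b := by omega
  -- (2) places: `v ∣ m ℓ`, `v ∤ m`, and `v` is the only place of `m ℓ` not over `m`
  have hvm : v ∉ placesDividing K m := by
    rw [mem_placesDividing_iff_natCast_mem hm0, natCast_mem_iff_exists_primeFactor_mem hm0]
    rintro ⟨q, hq, hqv⟩
    have := Summit.BirchSwinnertonDyer.Rank1Residual.JET.Walk.prime_eq_of_natCast_mem v
      (Nat.prime_of_mem_primeFactors hq) hℓp hqv hv
    exact hℓm (this ▸ Nat.dvd_of_mem_primeFactors hq)
  have hvmℓ : v ∈ placesDividing K (m * ℓ) := by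
    rw [mem_placesDividing_iff_natCast_mem hmℓ0, Nat.cast_mul]
    exact v.asIdeal.mul_mem_left _ hv
  have hvD : v ∈ placesDividing K (m * ℓ) \ placesDividing K m := Finset.mem_sdiff.mpr ⟨hvmℓ, hvm⟩
  have hDv : ∀ w ∈ placesDividing K (m * ℓ) \ placesDividing K m, w = v := by
    intro w hw
    rw [Finset.mem_sdiff] at hw
    obtain ⟨hw₁, hw₂⟩ := hw
    rw [mem_placesDividing_iff_natCast_mem hmℓ0, natCast_mem_iff_exists_primeFactor_mem hmℓ0] at hw₁
    obtain ⟨q, hq, hqw⟩ := hw₁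
    rw [Nat.primeFactors_mul hm0 hℓ0, hℓp.primeFactors, Finset.mem_union, Finset.mem_singleton] at hq
    rcases hq with hq | rfl
    · exact absurd ((mem_placesDividing_iff_natCast_mem hm0 w).mpr
        ((natCast_mem_iff_exists_primeFactor_mem hm0 w).mpr ⟨q, hq, hqw⟩)) hw₂
    · exact Summit.BirchSwinnertonDyer.Rank1Residual.JET.Walk.place_eq_of_natCast_mem_of_isPrime hℓ0
        hℓK.2.2.2.2.1 w v hqw hv
  -- (3) the classes `C' := 2^t c_M(nℓ) ∈ H¹_{𝓕(nℓ)}` (T2 + P4) and `C'' := 2^j C'`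
  have hC'F := zsmul_kolyvaginClass_mem_selmerF W Dt β ι 𝒯 (hK := hK) (hP4 := hP4) (hT2 := hT2) dup hNKol hM
    (fun q hq ↦ (hNK q hq).2)
  set C'' := ((2 ^ j : ℕ) : ℤ) • (((2 ^ t : ℕ) : ℤ) • dup.kolyvaginClass Nat.prime_two M) with hC''def
  have hC''N : C'' ∈ (selmerF W ((2 ^ M : ℕ) : ℤ) (𝒯 M) (placesDividing K (n * ℓ))).selmerGroup := by
    rw [hC''def]
    exact AddSubgroup.zsmul_mem _ hC'F _
  have hC''comm : C'' = ((2 ^ t : ℕ) : ℤ) • (((2 ^ j : ℕ) : ℤ) • dup.kolyvaginClass Nat.prime_two M) := by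
    rw [hC''def, smul_smul, smul_smul, mul_comm]
  have hC''sign : conjAct W τ ((2 ^ M : ℕ) : ℤ) C'' = ε • C'' := by
    rw [hC''def, map_zsmul, map_zsmul, hdupτ, smul_comm ((2 ^ t : ℕ) : ℤ) ε, smul_comm ((2 ^ j : ℕ) : ℤ) ε]
  -- (4) suppose, for contradiction, that `2^j c_M(nℓ)` is Kummer at every seed place
  by_contra H
  push Not at H
  -- then `C'' ∈ H¹_{𝓕(mℓ)}`
  have hC''F : C'' ∈ (selmerF W ((2 ^ M : ℕ) : ℤ) (𝒯 M) (placesDividing K (m * ℓ))).selmerGroup := by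
    refine mem_selmerGroup_selmerF_of_subset W _ (𝒯 M)
      (KolyvaginAtTwo.RegularWalk.placesDividing_subset_of_dvd (K := K) hN0 hmℓN) C'' hC''N fun w hwN hw ↦ ?_
    -- a seed place: `w ∣ q ∣ n / m`
    obtain ⟨q, hq, hqw⟩ := (natCast_mem_iff_exists_primeFactor_mem hN0 w).mp
      ((mem_placesDividing_iff_natCast_mem hN0 w).mp hwN)
    have hqmℓ : ¬ q ∣ m * ℓ := by
      intro hd
      apply hw
      rw [mem_placesDividing_iff_natCast_mem hmℓ0]
      obtain ⟨r, hr⟩ := hd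
      rw [hr, Nat.cast_mul]
      exact w.asIdeal.mul_mem_right _ hqw
    have hqp : q.Prime := Nat.prime_of_mem_primeFactors hq
    have hqn : q ∣ n := by
      rw [hNpf, Finset.mem_union, Finset.mem_singleton] at hq
      rcases hq with hq | rfl
      · exact Nat.dvd_of_mem_primeFactors hq
      · exact absurd (Dvd.intro_left m rfl) hqmℓ
    have hqm : ¬ q ∣ m := fun h ↦ hqmℓ (h.mul_right ℓ)
    have hqnm : q ∈ (n / m).primeFactors :=
      Nat.mem_primeFactors.mpr ⟨hqp, ((Nat.Prime.coprime_iff_not_dvd hqp).mpr hqm).dvd_of_dvd_mul_right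
        (by rwa [Nat.div_mul_cancel hmn]), hnm0⟩
    have hKum := (mem_selmerLocalKer_two_pow_iff W M w _).mp (H q hqnm w hqw)
    rw [hC''comm]
    exact mem_of_eq_of_mem_swap (AddSubgroup.zsmul_mem _ hKum ((2 ^ t : ℕ) : ℤ))
      (map_zsmul (galoisCohomology.localization ((W.baseChange K).torsionGaloisModule ((2 ^ M : ℕ) : ℤ))
        (Sum.inr w) 1) _ _)
  -- (5) ONE-term reciprocity at `v` (§1 with `c = m ℓ ⊇ m`)
  have hsum := sum_localTatePairing_eq_zero_of_dvd W 2 M (e M) (hμ M) (hadd₁ M) (hadd₂ M) (hgal M) (halt M)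
    (hnondeg M) hK hM (inv M) (fun v ↦ ((hperf M) v).1.injective) (hvan M) (𝒯 M) hmℓ0 (Dvd.intro ℓ rfl)
    (h𝒯sd M (m * ℓ)) z C'' hz hC''F
  rw [Finset.sum_eq_single_of_mem v hvD (fun w hw hwv ↦ absurd (hDv w hw) hwv)] at hsum
  -- (6) the inputs of P7a at `v`
  have hzKum : galoisCohomology.localization ((W.baseChange K).torsionGaloisModule ((2 ^ M : ℕ) : ℤ)) (Sum.inr v) 1 z ∈
      (W.baseChange K).kummerSelmerStructure ((2 ^ M : ℕ) : ℤ) (Sum.inr v) := by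
    have h := (SelmerStructure.mem_selmerGroup_iff _ z).mp hz (Sum.inr v)
    rwa [selmerF_inr, if_neg hvm] at h
  have hza' : ((2 ^ a : ℕ) : ℤ) • galoisCohomology.localization ((W.baseChange K).torsionGaloisModule
      ((2 ^ M : ℕ) : ℤ)) (Sum.inr v) 1 z ≠ 0 := fun h0 ↦
    hza ((mem_torsionLocalKer_two_pow_iff W M v _).mpr
      ((map_zsmul (galoisCohomology.localization ((W.baseChange K).torsionGaloisModule ((2 ^ M : ℕ) : ℤ))
        (Sum.inr v) 1) _ _).trans h0))
  have hQℓ := hQ2 W hCM K hK hne3 hne4 hHN hsur Dt β ι M hM n ℓ hN hℓp hℓn hNK' dat dup hσ hS hS' hemb v hv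
  have hC''b : ((2 ^ (b - t - j) : ℕ) : ℤ) • galoisCohomology.localization ((W.baseChange K).torsionGaloisModule
      ((2 ^ M : ℕ) : ℤ)) (Sum.inr v) 1 C'' ∉ (W.baseChange K).kummerSelmerStructure ((2 ^ M : ℕ) : ℤ) (Sum.inr v) := by
    intro h
    have h1 : ((2 ^ b : ℕ) : ℤ) • dup.kolyvaginClass Nat.prime_two M ∈
        selmerLocalKer (W.baseChange K) (v.adicCompletion K) ((2 ^ M : ℕ) : ℤ) := by
      refine (mem_selmerLocalKer_two_pow_iff W M v _).mpr ?_
      have h2 : ((2 ^ b : ℕ) : ℤ) • dup.kolyvaginClass Nat.prime_two M = ((2 ^ (b - t - j) : ℕ) : ℤ) • C'' := by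
        rw [hC''def, smul_smul, smul_smul, ← Nat.cast_mul, ← Nat.cast_mul, ← pow_add, ← pow_add,
          show b - t - j + j + t = b by omega]
      rw [h2]
      exact mem_of_eq_of_mem_swap h (map_zsmul (galoisCohomology.localization
        ((W.baseChange K).torsionGaloisModule ((2 ^ M : ℕ) : ℤ)) (Sum.inr v) 1) _ _)
    exact hcb ((hQℓ b).2.mp ((hQℓ b).1.mp h1))
  -- (7) P7a: the `v`-term is NOT killed by `2^(a + (b-t-j) + 1 - M - c₇)`; but it is zero — contradiction
  have hA := hP7a M ℓ v z C'' ε a (b - t - j) hε hℓK hℓI hv hzτ hC''sign hzKum hza' hC''b (by omega)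
  exact hA (by rw [hsum, smul_zero])

end Frame

end Summit.BirchSwinnertonDyer.BirchSwinnertonDyer.Theorems.KolyvaginLowerBoundAtTwo

end
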